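import Summits.AtomisticToContinuum.HydrodynamicLimit.Theorems.AntiMazurCoboundariesKineticWindowGronwallFramePrelim
import Summits.AtomisticToContinuum.HydrodynamicLimit.Theorems.AntiMazurCoboundariesKineticWindowGronwallBoostGibbs
import Summits.AtomisticToContinuum.HydrodynamicLimit.Theorems.AntiMazurCoboundariesKineticWindowGronwallThermalScalingGibbs
import Summits.AtomisticToContinuum.HydrodynamicLimit.Theorems.AntiMazurCoboundariesKineticWindowGronwallThermalFrame
import Summits.AtomisticToContinuum.HydrodynamicLimit.Theorems.KineticWindowGronwall.Negative.ActivityDummy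
import Literature.MathematicalPhysics.KineticTheory.HardSphereEulerProofs
import HarnessLib

/-!
# Frame covariance of the crux's antecedent, II: `KineticFluxLdDecay` has universal constants

Crux `Summit.AtomisticToContinuum.HydrodynamicLimit.Theses.AntiMazurCoboundaries.KineticWindowGronwall`
(stmt-AtomisticToContinuum-9282) `= (KineticFluxLdDecay → RelEntropyVanishing)`, line `dlr-block-transfer` v6, registered
helper stub `stub_kineticFrameUniv : KineticFluxLdDecayIffUniv` (lead prover, continuation c1); file 2 of 2 (file 1:
`…KineticWindowGronwallFramePrelim.lean` — statements, moving test functions, canonical-flow dictionary, window freezing).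

THE STATEMENT. In the crux's antecedent `A = KineticFluxLdDecay` the threshold `σ₀` is chosen after the frame
`(a, θ, u₀)` (activity, temperature, drift of the homogeneous local Gibbs law `G_N(a, u₀, θ)`) and the amplitude `κ` after
`σ`. We prove `A ↔ KineticFluxLdDecayUniv`, where the universal form has `∃ σ₀` FIRST and, for each `σ < σ₀`, ONE amplitude
`κ(σ)` serving every frame: the dependence of the constants on `(a, θ, u₀)` is fictitious. Consequently the crux is
equivalent to `KineticFluxLdDecayUniv → RelEntropyVanishing` (`crux_iff_univ_imp`).

THE PROOF is exact covariance of deterministic hard-sphere dynamics on `𝕋³`: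
* activity: at fixed particle number a constant activity cancels from the canonical density
  (`KineticWindowGronwallNegative.localGibbsLaw_const_activity`);
* temperature: the thermal scaling `v ↦ v/√θ`, `t ↦ t√θ` maps hard-sphere flows to hard-sphere flows
  (`KineticWindowGronwallThermalScaling.thermalScale`) and `G_N(1, 0, θ)` to `G_N(1, 0, 1)`, windows `τ` to `√θ τ`
  (`kineticWindow_thermal_drift`);
* drift: every flow is the canonical (regularised Alexander) flow a.e. at all forward times
  (`KineticWindowGronwallBoost.ae_forall_flow_eq_regFlow`), the velocity translation `v ↦ v + u₀` carries `G_N(1, 0, θ)` to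
  `G_N(1, u₀, θ)` (`lintegral_localGibbsLaw_velShift_zero`), and conjugating the canonical flow by the Galilean boost
  `boostAt u₀ t : (x, v) ↦ (x + t u₀, v + u₀)` gives an honest hard-sphere flow (`boostReg`); in the boosted frame the test
  function becomes the moving one `φ(x + s u₀)`, `0 ≤ s ≤ h = τ(N+1)^{-1/3} → 0`, and since `φ` is uniformly continuous on
  the compact torus and `|g| ≤ κ`, freezing it costs a factor `exp((N+1) κ η)` with `η → 0` (`stub_windowFreezing`),
  absorbed in `exp(δ(N+1))` at half the rate.
-/

noncomputable section

open MeasureTheory Filter Set Topology Function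
open scoped ENNReal
open Literature.MathematicalPhysics.KineticTheory Literature.Analysis.FluidPDE
open Summit.AtomisticToContinuum.HydrodynamicLimit.Theses.AntiMazurCoboundaries
open Summit.AtomisticToContinuum.HydrodynamicLimit.Theorems.KineticWindowGronwallBoost
open Summit.AtomisticToContinuum.HydrodynamicLimit.Theorems.KineticWindowGronwallThermalScaling

namespace Summit.AtomisticToContinuum.HydrodynamicLimit.Theorems.KineticWindowGronwallFrame

/-! ## §4 Proof of the registered statement -/

section Proof

variable {σ : ℝ} {N : ℕ}

/-- At time `0` the Galilean boost is the velocity translation of the statics file (`velShift`). [folklore] -/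
theorem velShift_eq_boostAt_zero (u : V3) (w : Config (N + 1) (Fin 3) T3) : velShift u w = boostAt u 0 w := by
  rw [boostAt_zero_right]
  rfl


/-- Kinetic windows shrink: `τ (N+1)^{-1/3} ≤ s₀` for all large `N` (`s₀ > 0`). [folklore] -/
theorem exists_window_le (τ : ℝ) {s₀ : ℝ} (hs₀ : 0 < s₀) :
    ∃ N₂ : ℕ, ∀ N : ℕ, N₂ ≤ N → τ * ((N + 1 : ℕ) : ℝ) ^ (-(1 / 3 : ℝ)) ≤ s₀ := by
  have h1 : Tendsto (fun N : ℕ => ((N + 1 : ℕ) : ℝ)) atTop atTop :=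
    tendsto_natCast_atTop_atTop.comp (tendsto_add_atTop_nat 1)
  have h2 : Tendsto (fun N : ℕ => ((N + 1 : ℕ) : ℝ) ^ (-(1 / 3 : ℝ))) atTop (𝓝 0) :=
    (tendsto_rpow_neg_atTop (by norm_num : (0 : ℝ) < 1 / 3)).comp h1
  have h3 : Tendsto (fun N : ℕ => τ * ((N + 1 : ℕ) : ℝ) ^ (-(1 / 3 : ℝ))) atTop (𝓝 0) := by
    simpa using h2.const_mul τ
  obtain ⟨N₂, hN₂⟩ := eventually_atTop.1 (h3.eventually (Iic_mem_nhds hs₀))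
  exact ⟨N₂, fun N hN => hN₂ N hN⟩

/-- The kinetic window is positive. [folklore] -/
theorem window_pos {τ : ℝ} (hτ : 0 < τ) (N : ℕ) : 0 < τ * ((N + 1 : ℕ) : ℝ) ^ (-(1 / 3 : ℝ)) :=
  mul_pos hτ (Real.rpow_pos_of_pos (by positivity) _)

/-- **The probability clause transfers between frames**: if the unit-frame law `G_N(1, 0, 1)` is a probability measure
then so is every `G_N(a, u₀, θ)`, `a, θ > 0` (activity dummy, thermal and Galilean push-forwards of probability
measures). [folklore] -/
theorem probClause_of_unit (hP₁ : ProbClause σ 1 1 0) {a θ : ℝ} (ha : 0 < a) (hθ : 0 < θ) (u₀ : V3) :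
    ProbClause σ a θ u₀ := by
  intro N Φ
  rw [KineticWindowGronwallNegative.localGibbsLaw_const_activity ha.ne']
  haveI h1 : IsProbabilityMeasure (localGibbsLaw σ (fun _ => (1 : ℝ)) (fun _ => (0 : V3)) (fun _ => (1 : ℝ)) N Φ) :=
    hP₁ N Φ
  have hc : 0 < Real.sqrt θ := Real.sqrt_pos.2 hθ
  have hθ1 : IsProbabilityMeasure (localGibbsLaw σ (fun _ => (1 : ℝ)) (fun _ => (0 : V3)) (fun _ => θ) N Φ) := by
    have h := localGibbsLaw_const_map_scaleVel σ 1 one_pos hc (0 : V3) N Φ Φ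
    rw [smul_zero, Real.sq_sqrt hθ.le, mul_one] at h
    rw [← h]
    exact Measure.isProbabilityMeasure_map (measurable_scaleVel_torus _).aemeasurable
  rw [← localGibbsLaw_const_map_velShift_zero σ 1 hθ u₀ N Φ Φ]
  exact Measure.isProbabilityMeasure_map (measurable_velShift u₀).aemeasurable

/-- **THE CORE ESTIMATE (one frame from the unit frame).** Fix `0 < σ < 1/2`, `θ > 0`, a drift `u₀`, a bounded continuous
pair `(φ, g)` with `|φ| ≤ 1`, `|g| ≤ κ`, a displacement tolerance `η` valid for `|s| ≤ s₀`, and a window `τ` with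
`h = τ(N+1)^{-1/3} ≤ s₀`. Then for EVERY flow `Φ` the window moment in the frame `(1, θ, u₀)` is at most
`exp((N+1) κ η)` times the unit-frame window moment, at window `√θ τ`, of the thermally rescaled boosted canonical flow. -/
theorem windowMoment_frame_le (hσ : 0 < σ) (hσh : σ < 2⁻¹) {θ : ℝ} (hθ : 0 < θ) (u₀ : V3) {φ : T3 → ℝ} {g : V3 → ℝ}
    (hφc : Continuous φ) (hgc : Continuous g) (hφ : ∀ x, |φ x| ≤ 1) {κ : ℝ} (hg : ∀ v, |g v| ≤ κ) {η s₀ τ : ℝ}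
    (hτ : 0 < τ) (N : ℕ) (hN : τ * ((N + 1 : ℕ) : ℝ) ^ (-(1 / 3 : ℝ)) ≤ s₀)
    (hη : ∀ s : ℝ, |s| ≤ s₀ → ∀ x : T3, |φ (x + Literature.Analysis.FunctionSpaces.Torus.proj (s • u₀)) - φ x| ≤ η)
    (Φ : TFlow σ N) :
    windowMoment σ 1 θ u₀ N Φ φ g τ ≤
      ENNReal.ofReal (Real.exp ((N + 1) * κ * η)) *
        windowMoment σ 1 1 0 N
          (thermalScale (boostReg (d := Fin 3) (hsDiameter_pos hσ N) (hsDiameter_lt_half hσ hσh N) (N + 1) (-u₀))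
            (Real.sqrt θ)⁻¹ (inv_pos.2 (Real.sqrt_pos.2 hθ))) φ g (Real.sqrt θ * τ) := by
  set hε := hsDiameter_pos hσ N
  set hε' := hsDiameter_lt_half hσ hσh N
  set Ψ₀ : TFlow σ N := boostReg (d := Fin 3) hε hε' (N + 1) (-u₀) with hΨ₀
  set h : ℝ := τ * ((N + 1 : ℕ) : ℝ) ^ (-(1 / 3 : ℝ))
  have hh : 0 < h := window_pos hτ N
  have hC : 0 ≤ Real.exp ((N + 1) * κ * η) := (Real.exp_pos _).le
  -- Step 1: every flow is the canonical flow inside the window functional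
  have hP : localGibbsLaw σ (fun _ => (1 : ℝ)) (fun _ => u₀) (fun _ => θ) N Φ ≪
      liouville (Torus.geometry (Fin 3)) (N + 1) (hsDiameter σ N) := by
    rw [localGibbsLaw_eq]
    exact localGibbsMeasure_absolutelyContinuous σ _ _ _ N Φ
  have step1 : windowMoment σ 1 θ u₀ N Φ φ g τ =
      ∫⁻ z, ENNReal.ofReal (Real.exp (h⁻¹ * ∫ s in (0 : ℝ)..h,
        obsSum φ g θ u₀ (Alexander.regFlow (Torus.geometry (Fin 3)) (hsDiameter σ N) s z)))
        ∂(localGibbsLaw σ (fun _ => (1 : ℝ)) (fun _ => u₀) (fun _ => θ) N Φ) :=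
    lintegral_window_congr_regFlow hε hε' Φ hP (fun y => ENNReal.ofReal (Real.exp (h⁻¹ * y))) (obsSum φ g θ u₀) hh.le
  -- Step 2: push the drift into the datum (velocity translation) and the flow (Galilean boost of the canonical flow)
  have step2 : ∫⁻ z, ENNReal.ofReal (Real.exp (h⁻¹ * ∫ s in (0 : ℝ)..h,
        obsSum φ g θ u₀ (Alexander.regFlow (Torus.geometry (Fin 3)) (hsDiameter σ N) s z)))
        ∂(localGibbsLaw σ (fun _ => (1 : ℝ)) (fun _ => u₀) (fun _ => θ) N Φ) =
      ∫⁻ w, ENNReal.ofReal (Real.exp (h⁻¹ * ∫ s in (0 : ℝ)..h,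
        obsSum (fun x => φ (x + Literature.Analysis.FunctionSpaces.Torus.proj (s • u₀))) g θ 0 (Ψ₀.flow s w)))
        ∂(localGibbsLaw σ (fun _ => (1 : ℝ)) (fun _ => (0 : V3)) (fun _ => θ) N Ψ₀) := by
    rw [lintegral_localGibbsLaw_velShift_zero σ 1 hθ u₀ N Ψ₀ Φ]
    refine lintegral_congr fun w => ?_
    congr 3
    refine intervalIntegral.integral_congr fun s _ => ?_
    simp only [velShift_eq_boostAt_zero, regFlow_boostAt_zero hε hε', obsSum_boostAt, hΨ₀]
  -- Step 3: freeze the moving test function (datum by datum)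
  have step3 : ∫⁻ w, ENNReal.ofReal (Real.exp (h⁻¹ * ∫ s in (0 : ℝ)..h,
        obsSum (fun x => φ (x + Literature.Analysis.FunctionSpaces.Torus.proj (s • u₀))) g θ 0 (Ψ₀.flow s w)))
        ∂(localGibbsLaw σ (fun _ => (1 : ℝ)) (fun _ => (0 : V3)) (fun _ => θ) N Ψ₀) ≤
      ∫⁻ w, ENNReal.ofReal (Real.exp ((N + 1) * κ * η)) *
        ENNReal.ofReal (Real.exp (h⁻¹ * ∫ s in (0 : ℝ)..h, obsSum φ g θ 0 (Ψ₀.flow s w)))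
        ∂(localGibbsLaw σ (fun _ => (1 : ℝ)) (fun _ => (0 : V3)) (fun _ => θ) N Ψ₀) := by
    refine lintegral_mono fun w => ?_
    have hle := window_moving_le_static Ψ₀ (measurable_boostReg_flow_left hε hε' (-u₀) w) hφc hgc hφ hg θ u₀ hh hN hη
    rw [← ENNReal.ofReal_mul hC, ← Real.exp_add]
    refine ENNReal.ofReal_le_ofReal (Real.exp_le_exp.2 ?_)
    linarith
  -- Step 4: recognise the centred window moment of `Ψ₀` and move to the unit temperature
  have step4 : ∫⁻ w, ENNReal.ofReal (Real.exp ((N + 1) * κ * η)) *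
        ENNReal.ofReal (Real.exp (h⁻¹ * ∫ s in (0 : ℝ)..h, obsSum φ g θ 0 (Ψ₀.flow s w)))
        ∂(localGibbsLaw σ (fun _ => (1 : ℝ)) (fun _ => (0 : V3)) (fun _ => θ) N Ψ₀) =
      ENNReal.ofReal (Real.exp ((N + 1) * κ * η)) * windowMoment σ 1 θ 0 N Ψ₀ φ g τ := by
    rw [lintegral_const_mul' _ _ ENNReal.ofReal_ne_top]
    rfl
  have step5 : windowMoment σ 1 θ 0 N Ψ₀ φ g τ =
      windowMoment σ 1 1 0 N (thermalScale Ψ₀ (Real.sqrt θ)⁻¹ (inv_pos.2 (Real.sqrt_pos.2 hθ))) φ g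
        (Real.sqrt θ * τ) :=
    kineticWindow_thermal_drift σ 1 hθ N Ψ₀ φ g τ
  calc windowMoment σ 1 θ u₀ N Φ φ g τ
      = _ := step1
    _ = _ := step2
    _ ≤ _ := step3
    _ = _ := step4
    _ = _ := by rw [step5]

/-- **`A → A_univ`**: the frame-wise antecedent at the unit frame `(1, 1, 0)` yields, for every `σ` below
`min σ₀(1,1,0) (1/2)`, ONE amplitude serving every frame. [folklore] -/
theorem kineticFluxLdDecayUniv_of (hA : KineticFluxLdDecay) : KineticFluxLdDecayUniv := by
  obtain ⟨σ₁, hσ₁, H₁⟩ := hA 1 1 0 one_pos one_pos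
  refine ⟨min σ₁ 2⁻¹, lt_min hσ₁ (by norm_num), fun σ hσ hσ' => ?_⟩
  have hσ₁' : σ < σ₁ := hσ'.trans_le (min_le_left _ _)
  have hσh : σ < 2⁻¹ := hσ'.trans_le (min_le_right _ _)
  obtain ⟨hP₁, κ, hκ, Hκ⟩ := H₁ σ hσ hσ₁'
  refine ⟨κ, hκ, fun a θ u₀ ha hθ => ⟨probClause_of_unit hP₁ ha hθ u₀, ?_⟩⟩
  intro φ g hφc hgc hφ hg horth δ hδ
  -- the unit-frame bound at half the rate
  obtain ⟨τ₁, hτ₁, N₁, HN₁⟩ := Hκ φ g hφc hgc hφ hg horth (δ / 2) (half_pos hδ)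
  -- displacement tolerance `η = δ / (2κ)` and its range `s₀`
  obtain ⟨s₀, hs₀, hη⟩ := exists_displacement_small φ hφc u₀ (div_pos hδ (mul_pos two_pos hκ) : 0 < δ / (2 * κ))
  -- the window in the frame `θ`: `τ = τ₁ / √θ`, so that `√θ τ = τ₁`
  have hc : 0 < Real.sqrt θ := Real.sqrt_pos.2 hθ
  set τ : ℝ := (Real.sqrt θ)⁻¹ * τ₁ with hτ_def
  have hτ : 0 < τ := mul_pos (inv_pos.2 hc) hτ₁
  have hττ₁ : Real.sqrt θ * τ = τ₁ := by rw [hτ_def, ← mul_assoc, mul_inv_cancel₀ hc.ne', one_mul]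
  obtain ⟨N₂, hN₂⟩ := exists_window_le τ hs₀
  refine ⟨τ, hτ, max N₁ N₂, fun N hN Φ => ?_⟩
  have hN₁' : N₁ ≤ N := (le_max_left _ _).trans hN
  have hN₂' : N₂ ≤ N := (le_max_right _ _).trans hN
  -- activity dummy, then the core estimate, then the unit-frame bound
  have hact : windowMoment σ a θ u₀ N Φ φ g τ = windowMoment σ 1 θ u₀ N Φ φ g τ := by
    simp only [windowMoment, KineticWindowGronwallNegative.localGibbsLaw_const_activity ha.ne']
  rw [hact]
  refine (windowMoment_frame_le hσ hσh hθ u₀ hφc hgc hφ hg hτ N (hN₂ N hN₂') hη Φ).trans ?_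
  rw [hττ₁]
  set Ψ₁ : TFlow σ N := thermalScale (boostReg (d := Fin 3) (hsDiameter_pos hσ N) (hsDiameter_lt_half hσ hσh N) (N + 1)
    (-u₀)) (Real.sqrt θ)⁻¹ (inv_pos.2 (Real.sqrt_pos.2 hθ))
  have hW : windowMoment σ 1 1 0 N Ψ₁ φ g τ₁ ≤ ENNReal.ofReal (Real.exp (δ / 2 * (N + 1))) := HN₁ N hN₁' Ψ₁
  refine (mul_le_mul_right hW _).trans ?_
  rw [← ENNReal.ofReal_mul (Real.exp_pos _).le, ← Real.exp_add]
  refine ENNReal.ofReal_le_ofReal (Real.exp_le_exp.2 (le_of_eq ?_))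
  have hκ0 : κ ≠ 0 := hκ.ne'
  field_simp
  ring

/-- **`A_univ → A`**: the universal form specialises to the frame-wise form (instantiation). [folklore] -/
theorem kineticFluxLdDecay_of_univ (h : KineticFluxLdDecayUniv) : KineticFluxLdDecay := by
  obtain ⟨σ₀, hσ₀, H⟩ := h
  intro a θ u₀ ha hθ
  refine ⟨σ₀, hσ₀, fun σ hσ hσ' => ?_⟩
  obtain ⟨κ, hκ, Hκ⟩ := H σ hσ hσ'
  obtain ⟨hP, hB⟩ := Hκ a θ u₀ ha hθ
  exact ⟨hP, κ, hκ, hB⟩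

/-- **THE REGISTERED HELPER STUB `stub_kineticFrameUniv`** (crux `KineticWindowGronwall`, line `dlr-block-transfer` v6):
`KineticFluxLdDecay ↔ KineticFluxLdDecayUniv` — the threshold and the amplitude of the crux's antecedent do not depend on
the frame `(a, θ, u₀)`. [folklore] -/
theorem stub_kineticFrameUniv : KineticFluxLdDecayIffUniv :=
  ⟨kineticFluxLdDecayUniv_of, kineticFluxLdDecay_of_univ⟩

/-- **Consequence for the crux**: `KineticWindowGronwall ↔ (KineticFluxLdDecayUniv → RelEntropyVanishing)` — the crux may
be attacked with its antecedent in the universal frame form (one `σ₀`, one `κ(σ)` for all activities, temperatures and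
drifts). [folklore] -/
theorem crux_iff_univ_imp : KineticWindowGronwall ↔ (KineticFluxLdDecayUniv → RelEntropyVanishing) := by
  rw [show KineticWindowGronwall = (KineticFluxLdDecay → RelEntropyVanishing) from rfl]
  exact Iff.intro (fun h hU => h (kineticFluxLdDecay_of_univ hU)) (fun h hA => h (kineticFluxLdDecayUniv_of hA))

end Proof

end Summit.AtomisticToContinuum.HydrodynamicLimit.Theorems.KineticWindowGronwallFrame

end
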